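/-
Fleet lead `ym-wcr-19609-p1` (seat prover-ym-wcr-19609-p1-g2-0), route `WeakCouplingRates`, crux `BulkDominatesColdBoxW`
(stmt-QuantumFields-19609), line `dlr-chessboard`, skeleton v5 (sha16 5c2c32c11bf29ef1).
-/
import Summits.QuantumFields.YangMills.Theorems.WeakCouplingRatesBulkDominatesColdBoxWDirKernelTwoPoint

/-!
# Crux `BulkDominatesColdBoxW`, line `dlr-chessboard` v5: registered stub `stub_dirKernelTwoPoint` BY NAME

The v5 sub-stub N1 of L1a (`Stmt.stub_dirKernelTwoPoint : ∀ A θ, 0 < A → A < θ → DirKernelTwoPoint A θ`, interface of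
`Theorems/WeakCouplingRatesBulkDominatesColdBoxWDefs.lean`) is the tree theorem `dirKernelTwoPoint` of
`Theorems/WeakCouplingRatesBulkDominatesColdBoxWDirKernelTwoPoint.lean` (fleet seat `ym-spine-20043-p1` g3: `1/(4π²T⁴) ≤ C_D(p_c, p_c + Te₀) ≤ 1`
from the Dirichlet-vs-`ℤ⁴` comparison, `C(T) = T⁻⁴/π² + O(T⁻⁵)` and `integral_dirCirc_sq_le_one`).  This file only records it under the
registered name and signature.  NOT a claim about the mass gap.
-/

set_option autoImplicit false

namespace Summit.QuantumFields.YangMills.Theorems.WeakCouplingRates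

/-- **Registered stub `stub_dirKernelTwoPoint` of line `dlr-chessboard` (v5)**: Coulomb size of the Dirichlet curvature two-point kernel
at depth `⌈β^A⌉ ≪ ⌈β^θ⌉`, for all `0 < A < θ` — by name, from `dirKernelTwoPoint`. -/
theorem stub_dirKernelTwoPoint : ∀ A θ : ℝ, 0 < A → A < θ → DirKernelTwoPoint A θ :=
  fun _ _ hA hAθ => dirKernelTwoPoint hA hAθ

end Summit.QuantumFields.YangMills.Theorems.WeakCouplingRates
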